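import Summits.QuantumFields.YangMills.Theorems.BalabanUVNodesN19TriangleWaveSquareFunction
import Summits.QuantumFields.YangMills.Theorems.BalabanUVNodesN19UniformMomentSummabilityThreshold
import Mathlib.MeasureTheory.Integral.IntervalIntegral.AbsolutelyContinuousFun
import Mathlib.MeasureTheory.Function.AbsolutelyContinuous
import Mathlib.Analysis.Calculus.FDeriv.Measurable

/-!
# YM-DAG node N19 (= NE7 proper) — FIXED OBSERVABLES UNDER THE UNIFORM-MOMENT CURRENCY, III: EVERY FIXED LIPSCHITZ TEST RIDES THE
# CHEBYSHEV-ARC CHAINS ABSOLUTELY SUMMABLY — `Σ_n |Σ_k (−1)^k ∫_{x_{k+1}}^{x_k} G| ≤ (π³∕6)(K+B)`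

Cell `pub-ymgap`, HUMAN RULING D-0062 (Track A) ∕ D-0149 (work-bound push), R141 (C) wider-strategy seat `pub-ymgap-dag-n19-e` (strategy s3 =
ALTERNATIVE CURRENCY), generation g24, module 3 (lineage module 87; parts I∕II = modules 85∕86 `…N19TriangleWaveBessel` ∕ `…N19TriangleWaveSquareFunction`,
parts IV∕V = modules 88∕89 `…N19FixedTestLawPairs` ∕ `…N19UniformMomentsFixedTestsSummable`).  Route `Summits/QuantumFields/YangMills/Theses/BalabanUVNodes.lean` rev 25, cluster item K3⁷
«SpineGivenEndpointR13SepCoPH» (stmt-QuantumFields-20544); filed `--supports` that item `--as helper` (it proves no registered stub).  COUNT-NEUTRAL: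
[folklore] real analysis over Mathlib (`AbsolutelyContinuousOnInterval.integral_mul_deriv_eq_deriv_mul` ∕ `integral_deriv_eq_sub` — integration by parts
and the fundamental theorem for absolutely continuous functions; `LipschitzWith.of_dist_le'`, `norm_deriv_le_of_lipschitz`, `measurable_deriv`;
`intervalIntegral.integral_comp_mul_deriv`; the Chebyshev extremal `node`s; `arccos_cos`, `cos_sub_nat_mul_two_pi`) + parts I∕II and module 71
(`node_succ_lt`) BY NAME; no scheme object, no Theses import; NOT a discharge claim.

THE QUESTION (HOME `CURRENCY-MAP.md` v2, open item (w)).  Under the UNIFORM-MOMENT currency at geometric closeness, do the increments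
`|E_{K+1}g − E_K g|` of a FIXED Lipschitz observable have to be summable?  Module 83 answered NO for the WINDOW currency (one lacunary `g` with `Σ = ∞` under
`Target` at geometric remainders).  The only uniform-moment lower-bound family in the tree is the Chebyshev-arc chain (modules 71∕72∕78∕79): `P_n, Q_n` =
Lebesgue measure on the even ∕ odd gaps between the extrema `x_k = cos(kπ∕n)`, whose difference on a test `f` is THE ALTERNATING ARC FUNCTIONAL
`A_n(f) = Σ_{k<n} (−1)^k ∫_{x_{k+1}}^{x_k} f`; along the level-`n` tests it is `1∕(2n)` — harmonic, not summable (modules 72∕73∕79).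
THE ANSWER ALONG ARC CHAINS (this file): for ONE FIXED test the functionals are ABSOLUTELY SUMMABLE over the levels.
§1 ★ `altArc_eq_neg_div_integral_deriv_mul_triangle`: for `G` continuous, `K`-Lipschitz and `B`-bounded on `[−1,1]`, `n ≥ 1`:
`A_n(G) = −(1∕n)∫_0^π F′(θ)(arccos(cos(nθ)) − π∕2)dθ`, `F(θ) = G(cos θ) sin θ` (`(K+B)`-Lipschitz on `ℝ`, so absolutely continuous with `|F′| ≤ K+B`):
the substitution `x = cos θ` makes the gaps EQUAL (`[kπ∕n,(k+1)π∕n]`), on each gap the triangle wave `arccos(cos(nθ))` is affine with slope `±n`,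
integration by parts gap by gap, the boundary terms telescope to `F(0) = F(π) = 0`, and `∫_0^π F′ = 0` removes the mean `π∕2`.
§2 ★★ `sum_abs_altArc_le` ∕ `summable_abs_altArc`: `Σ_{n≥1} |A_n(G)| ≤ (π³∕6)(K+B)` — module 86's square-function bound with `f = F′`.
SEQUEL.  Module 88 (`…N19FixedTestLawPairs`) turns this into bounds for law pairs and arc chains (any scale `|s| ≤ 1`, any chain visiting each level at most
`m` times: fixed-test increments `≤ m(π³∕6)(K+B)`), and module 89 instantiates it on a geometric uniform-moment witness whose bounded-Lipschitz increments
are NOT summable: the uniform currency shows NO module-83 phenomenon along its natural witnesses.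
HONEST LIMIT.  This is a statement about arc chains, not about every uniform-moment sequence: whether SOME sequence of laws with all moments
`Cθ^K`-close makes a fixed Lipschitz observable non-summable stays OPEN (HOME `CURRENCY-MAP.md` v3 records the Banach–Steinhaus heuristic; not typed).

HONEST FRAMING (binding).  Elementary and [folklore] (Bessel ∕ Chebyshev–Favard arcs); toy laws, no scheme object; NO consumer in the DAG today (a structural
statement about the seat's own currencies); nothing of Bałaban's instantiated; NE7 NOT PRINTED, NOT proved; N19 NOT discharged; count-neutral.  One finite `T⁴`
programme at fixed `ε`; nothing continuum ∕ `ℝ⁴` ∕ OS ∕ mass-gap ∕ Clay.  0 `def` ∕ 0 `sorry`.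
-/

noncomputable section

open Real Finset MeasureTheory Polynomial.Chebyshev

namespace Summit.QuantumFields.YangMills.Theorems.BalabanUVNodesN19FixedTestArcChains

open Summit.QuantumFields.YangMills.Theorems.BalabanUVNodesN19TriangleWaveBessel (intervalIntegrable_of_bounded)
open Summit.QuantumFields.YangMills.Theorems.BalabanUVNodesN19TriangleWaveSquareFunction
  (sum_div_abs_integral_mul_triangle_le)
open Summit.QuantumFields.YangMills.Theorems.BalabanUVNodesN19ChebyshevArcFunctional (node_succ_lt)

/-! ## §1 The alternating arc functional after `x = cos θ` [folklore] -/

/-- The gap substitution `x = cos θ`: `∫_{x_{k+1}}^{x_k} G = ∫_{kπ∕n}^{(k+1)π∕n} G(cos θ) sin θ dθ` (`x_k = cos(kπ∕n)`). [folklore] -/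
theorem integral_arc_eq_integral_angle {G : ℝ → ℝ} (hG : Continuous G) (n k : ℕ) :
    ∫ x in node n (k + 1)..node n k, G x =
      ∫ θ in ((k : ℝ) * π / n)..(((k : ℝ) + 1) * π / n), G (Real.cos θ) * Real.sin θ := by
  have h := intervalIntegral.integral_comp_mul_deriv (a := (k : ℝ) * π / n) (b := ((k : ℝ) + 1) * π / n)
    (f := Real.cos) (f' := fun θ => -Real.sin θ) (g := G) (fun θ _ => Real.hasDerivAt_cos θ)
    (Real.continuous_sin.neg).continuousOn hG
  have e1 : node n (k + 1) = Real.cos (((k : ℝ) + 1) * π / n) := by rw [node]; push_cast; ring_nf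
  have e2 : node n k = Real.cos ((k : ℝ) * π / n) := by rw [node]
  rw [e1, e2, intervalIntegral.integral_symm, ← h, ← intervalIntegral.integral_neg]
  exact intervalIntegral.integral_congr fun θ _ => by simp only [Function.comp_apply]; ring

section Test

variable {G : ℝ → ℝ} {K B : ℝ}

/-- A Lipschitz constant on `[−1,1]` is nonnegative (compare the endpoints). [bookkeeping] -/
theorem lipConst_nonneg (hK : ∀ x y : ℝ, x ∈ Set.Icc (-1 : ℝ) 1 → y ∈ Set.Icc (-1 : ℝ) 1 → |G x - G y| ≤ K * |x - y|) : 0 ≤ K := by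
  have h := hK 1 (-1) ⟨by norm_num, le_rfl⟩ ⟨le_rfl, by norm_num⟩
  have h2 : (0 : ℝ) ≤ |G 1 - G (-1)| := abs_nonneg _
  rw [show (1 : ℝ) - -1 = 2 by ring, abs_two] at h
  linarith

/-- A bound on `[−1,1]` is nonnegative. [bookkeeping] -/
theorem bound_nonneg (hB : ∀ x : ℝ, x ∈ Set.Icc (-1 : ℝ) 1 → |G x| ≤ B) : 0 ≤ B :=
  (abs_nonneg _).trans (hB 0 ⟨by norm_num, by norm_num⟩)

/-- `F(θ) = G(cos θ)·sin θ` is `(K+B)`-Lipschitz on `ℝ` when `G` is `K`-Lipschitz and `B`-bounded on `[−1,1]` (`cos θ ∈ [−1,1]`;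
`|sin θ − sin θ'|, |cos θ − cos θ'| ≤ |θ − θ'|`). [folklore] -/
theorem lipschitzWith_compCos_mul_sin
    (hK : ∀ x y : ℝ, x ∈ Set.Icc (-1 : ℝ) 1 → y ∈ Set.Icc (-1 : ℝ) 1 → |G x - G y| ≤ K * |x - y|)
    (hB : ∀ x : ℝ, x ∈ Set.Icc (-1 : ℝ) 1 → |G x| ≤ B) :
    LipschitzWith (Real.toNNReal (K + B)) (fun θ : ℝ => G (Real.cos θ) * Real.sin θ) := by
  refine LipschitzWith.of_dist_le' fun θ θ' => ?_
  have hK0 := lipConst_nonneg hK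
  have hc : ∀ t : ℝ, Real.cos t ∈ Set.Icc (-1 : ℝ) 1 := fun t => ⟨Real.neg_one_le_cos t, Real.cos_le_one t⟩
  rw [Real.dist_eq, Real.dist_eq]
  have e : G (Real.cos θ) * Real.sin θ - G (Real.cos θ') * Real.sin θ' =
      G (Real.cos θ) * (Real.sin θ - Real.sin θ') + Real.sin θ' * (G (Real.cos θ) - G (Real.cos θ')) := by ring
  rw [e]
  calc |G (Real.cos θ) * (Real.sin θ - Real.sin θ') + Real.sin θ' * (G (Real.cos θ) - G (Real.cos θ'))|
      ≤ |G (Real.cos θ)| * |Real.sin θ - Real.sin θ'| + |Real.sin θ'| * |G (Real.cos θ) - G (Real.cos θ')| := by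
        refine (abs_add_le _ _).trans ?_
        rw [abs_mul, abs_mul]
    _ ≤ B * |θ - θ'| + 1 * (K * |θ - θ'|) := by
        refine add_le_add (mul_le_mul (hB _ (hc θ)) (Real.abs_sin_sub_sin_le θ θ') (abs_nonneg _) (bound_nonneg hB))
          (mul_le_mul (Real.abs_sin_le_one θ') ?_ (abs_nonneg _) zero_le_one)
        exact (hK _ _ (hc θ) (hc θ')).trans (mul_le_mul_of_nonneg_left (Real.abs_cos_sub_cos_le θ θ') hK0)
    _ = (K + B) * |θ - θ'| := by ring

/-- `|F′| ≤ K + B` everywhere (Lipschitz bound on the derivative; `deriv = 0` where `F` is not differentiable). [folklore] -/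
theorem abs_deriv_compCos_mul_sin_le
    (hK : ∀ x y : ℝ, x ∈ Set.Icc (-1 : ℝ) 1 → y ∈ Set.Icc (-1 : ℝ) 1 → |G x - G y| ≤ K * |x - y|)
    (hB : ∀ x : ℝ, x ∈ Set.Icc (-1 : ℝ) 1 → |G x| ≤ B) (θ : ℝ) :
    |deriv (fun θ : ℝ => G (Real.cos θ) * Real.sin θ) θ| ≤ K + B := by
  have h := norm_deriv_le_of_lipschitz (x₀ := θ) (lipschitzWith_compCos_mul_sin hK hB)
  rwa [Real.norm_eq_abs, Real.coe_toNNReal _ (add_nonneg (lipConst_nonneg hK) (bound_nonneg hB))] at h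

/-- THE GAP INTEGRATION BY PARTS.  On the `k`-th angular gap `[kπ∕n, (k+1)π∕n]` the triangle wave `arccos(cos(nθ))` is affine with slope `(−1)^k n`,
so `(−1)^k∫_gap F = (π∕2n)((−1)^k(F(b)+F(a)) + (F(b)−F(a))) − (1∕n)∫_gap F′(θ)·arccos(cos(nθ))dθ` (`F = G∘cos·sin`, absolutely continuous). [folklore] -/
theorem altArc_gap_eq
    (hK : ∀ x y : ℝ, x ∈ Set.Icc (-1 : ℝ) 1 → y ∈ Set.Icc (-1 : ℝ) 1 → |G x - G y| ≤ K * |x - y|)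
    (hB : ∀ x : ℝ, x ∈ Set.Icc (-1 : ℝ) 1 → |G x| ≤ B) {n : ℕ} (hn : n ≠ 0) (k : ℕ) :
    (-1 : ℝ) ^ k * ∫ θ in ((k : ℝ) * π / n)..(((k : ℝ) + 1) * π / n), G (Real.cos θ) * Real.sin θ =
      π / (2 * n) * ((-1 : ℝ) ^ k * (G (Real.cos (((k : ℝ) + 1) * π / n)) * Real.sin (((k : ℝ) + 1) * π / n) +
          G (Real.cos ((k : ℝ) * π / n)) * Real.sin ((k : ℝ) * π / n)) +
        (G (Real.cos (((k : ℝ) + 1) * π / n)) * Real.sin (((k : ℝ) + 1) * π / n) -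
          G (Real.cos ((k : ℝ) * π / n)) * Real.sin ((k : ℝ) * π / n))) -
      1 / n * ∫ θ in ((k : ℝ) * π / n)..(((k : ℝ) + 1) * π / n),
        deriv (fun θ : ℝ => G (Real.cos θ) * Real.sin θ) θ * Real.arccos (Real.cos (n * θ)) := by
  set F : ℝ → ℝ := fun θ => G (Real.cos θ) * Real.sin θ with hFdef
  set a : ℝ := (k : ℝ) * π / n with ha
  set b : ℝ := ((k : ℝ) + 1) * π / n with hb
  have hnr : (0 : ℝ) < n := by exact_mod_cast Nat.pos_of_ne_zero hn
  have hab : a ≤ b := by rw [ha, hb]; exact div_le_div_of_nonneg_right (by nlinarith [Real.pi_pos]) hnr.le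
  have hba : b - a = π / n := by rw [ha, hb]; field_simp; ring
  have hFac : AbsolutelyContinuousOnInterval F a b :=
    ((lipschitzWith_compCos_mul_sin hK hB).lipschitzOnWith (s := Set.uIcc a b)).absolutelyContinuousOnInterval
  -- the triangle wave on the gap: `n(θ − a)` for even `k`, `n(b − θ)` for odd `k`
  have hgapθ : ∀ θ ∈ Set.uIcc a b, a ≤ θ ∧ θ ≤ b := fun θ hθ => by rwa [Set.uIcc_of_le hab, Set.mem_Icc] at hθ
  rcases Nat.even_or_odd k with ⟨j, hj⟩ | ⟨j, hj⟩
  · -- EVEN `k = 2j`: `arccos(cos(nθ)) = nθ − kπ = n(θ − a)`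
    have htri : ∀ θ ∈ Set.uIcc a b, Real.arccos (Real.cos (n * θ)) = n * (θ - a) := by
      intro θ hθ
      obtain ⟨h1, h2⟩ := hgapθ θ hθ
      have e : (n : ℝ) * (θ - a) = n * θ - j * (2 * π) := by rw [ha, hj]; push_cast; field_simp; ring
      have hlo : 0 ≤ (n : ℝ) * (θ - a) := mul_nonneg hnr.le (by linarith)
      have hhi : (n : ℝ) * (θ - a) ≤ π := by
        have : (n : ℝ) * (θ - a) ≤ n * (b - a) := mul_le_mul_of_nonneg_left (by linarith) hnr.le
        rw [hba, mul_div_cancel₀ _ hnr.ne'] at this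
        exact this
      rw [← Real.arccos_cos hlo hhi, e, Real.cos_sub_nat_mul_two_pi]
    have hkpow : (-1 : ℝ) ^ k = 1 := by rw [hj, ← two_mul]; exact (even_two_mul j).neg_one_pow
    -- IBP against `g(θ) = θ − a`
    have hgac : AbsolutelyContinuousOnInterval (fun θ : ℝ => θ - a) a b :=
      ((contDiff_id.sub contDiff_const).contDiffOn (s := Set.uIcc a b)).absolutelyContinuousOnInterval
    have hibp := hFac.integral_mul_deriv_eq_deriv_mul hgac
    have hdg : ∀ θ, deriv (fun θ : ℝ => θ - a) θ = 1 := fun θ => by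
      rw [deriv_sub_const, deriv_id'']
    simp_rw [hdg, mul_one, sub_self, mul_zero, sub_zero] at hibp
    -- `∫ F′·arccos(cos(n·)) = n ∫ F′·(θ − a)`
    have hI : ∫ θ in a..b, deriv F θ * Real.arccos (Real.cos (n * θ)) = n * ∫ θ in a..b, deriv F θ * (θ - a) := by
      rw [← intervalIntegral.integral_const_mul]
      exact intervalIntegral.integral_congr fun θ hθ => by rw [htri θ hθ]; ring
    rw [hkpow, one_mul, one_mul, hI, hibp, hba]
    field_simp
    ring
  · -- ODD `k = 2j+1`: `arccos(cos(nθ)) = (k+1)π − nθ = n(b − θ)`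
    have htri : ∀ θ ∈ Set.uIcc a b, Real.arccos (Real.cos (n * θ)) = n * (b - θ) := by
      intro θ hθ
      obtain ⟨h1, h2⟩ := hgapθ θ hθ
      have e : (n : ℝ) * (b - θ) = ((j + 1 : ℕ) : ℝ) * (2 * π) - n * θ := by rw [hb, hj]; push_cast; field_simp; ring
      have hlo : 0 ≤ (n : ℝ) * (b - θ) := mul_nonneg hnr.le (by linarith)
      have hhi : (n : ℝ) * (b - θ) ≤ π := by
        have : (n : ℝ) * (b - θ) ≤ n * (b - a) := mul_le_mul_of_nonneg_left (by linarith) hnr.le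
        rw [hba, mul_div_cancel₀ _ hnr.ne'] at this
        exact this
      rw [← Real.arccos_cos hlo hhi, e, Real.cos_nat_mul_two_pi_sub]
    have hkpow : (-1 : ℝ) ^ k = -1 := by rw [hj]; exact (odd_two_mul_add_one j).neg_one_pow
    have hgac : AbsolutelyContinuousOnInterval (fun θ : ℝ => b - θ) a b :=
      ((contDiff_const.sub contDiff_id).contDiffOn (s := Set.uIcc a b)).absolutelyContinuousOnInterval
    have hibp := hFac.integral_mul_deriv_eq_deriv_mul hgac
    have hdg : ∀ θ, deriv (fun θ : ℝ => b - θ) θ = -1 := fun θ => by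
      rw [deriv_const_sub, deriv_id'']
    simp_rw [hdg, sub_self, mul_zero, zero_sub] at hibp
    have hI : ∫ θ in a..b, deriv F θ * Real.arccos (Real.cos (n * θ)) = n * ∫ θ in a..b, deriv F θ * (b - θ) := by
      rw [← intervalIntegral.integral_const_mul]
      exact intervalIntegral.integral_congr fun θ hθ => by rw [htri θ hθ]; ring
    have hneg : ∫ θ in a..b, F θ * -1 = -∫ θ in a..b, F θ := by
      rw [← intervalIntegral.integral_neg]; exact intervalIntegral.integral_congr fun θ _ => by ring
    rw [hneg] at hibp
    have e2 : ∫ θ in a..b, F θ = F a * (b - a) + ∫ θ in a..b, deriv F θ * (b - θ) := by linarith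
    rw [hkpow, hI, e2, hba]
    field_simp
    ring

/-- The alternating telescope: `Σ_{k<n} (−1)^k (u(k+1) + u(k)) = u(0) − (−1)^n u(n)`. [bookkeeping] -/
theorem alt_sum_succ_add (u : ℕ → ℝ) (n : ℕ) :
    ∑ k ∈ Finset.range n, (-1 : ℝ) ^ k * (u (k + 1) + u k) = u 0 - (-1 : ℝ) ^ n * u n := by
  induction n with
  | zero => simp
  | succ n ih => rw [Finset.sum_range_succ, ih, pow_succ]; ring

/-- ★ **THE ALTERNATING ARC FUNCTIONAL IS A TRIANGLE-WAVE INTEGRAL OF `F′`.**  For a continuous `G`, `K`-Lipschitz and `B`-bounded on `[−1,1]`, and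
`n ≥ 1`: `Σ_{k<n} (−1)^k ∫_{x_{k+1}}^{x_k} G = −(1∕n)·∫_0^π F′(θ)(arccos(cos(nθ)) − π∕2)dθ` with `F(θ) = G(cos θ)sin θ` (the boundary terms telescope
to `F(0) = F(π) = 0`, and `∫_0^π F′ = 0` removes the mean `π∕2` of the triangle wave). [folklore] -/
theorem altArc_eq_neg_div_integral_deriv_mul_triangle (hG : Continuous G)
    (hK : ∀ x y : ℝ, x ∈ Set.Icc (-1 : ℝ) 1 → y ∈ Set.Icc (-1 : ℝ) 1 → |G x - G y| ≤ K * |x - y|)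
    (hB : ∀ x : ℝ, x ∈ Set.Icc (-1 : ℝ) 1 → |G x| ≤ B) {n : ℕ} (hn : n ≠ 0) :
    ∑ k ∈ Finset.range n, (-1 : ℝ) ^ k * ∫ x in node n (k + 1)..node n k, G x =
      -(1 / n) * ∫ θ in (0 : ℝ)..π,
        deriv (fun θ : ℝ => G (Real.cos θ) * Real.sin θ) θ * (Real.arccos (Real.cos (n * θ)) - π / 2) := by
  set F : ℝ → ℝ := fun θ => G (Real.cos θ) * Real.sin θ with hFdef
  have hnr : (0 : ℝ) < n := by exact_mod_cast Nat.pos_of_ne_zero hn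
  set a : ℕ → ℝ := fun k => (k : ℝ) * π / n with ha
  have ha1 : ∀ k : ℕ, ((k : ℝ) + 1) * π / n = a (k + 1) := fun k => by simp only [ha]; push_cast; ring
  -- gap by gap
  have hgap : ∀ k ∈ Finset.range n, (-1 : ℝ) ^ k * ∫ x in node n (k + 1)..node n k, G x =
      π / (2 * n) * ((-1 : ℝ) ^ k * (F (a (k + 1)) + F (a k)) + (F (a (k + 1)) - F (a k))) -
        1 / n * ∫ θ in (a k)..(a (k + 1)), deriv F θ * Real.arccos (Real.cos (n * θ)) := by
    intro k _
    rw [integral_arc_eq_integral_angle hG n k, altArc_gap_eq hK hB hn k, ha1 k]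
  have halt := alt_sum_succ_add (fun i => F (a i)) n
  have htel := Finset.sum_range_sub (fun i => F (a i)) n
  beta_reduce at halt htel
  rw [Finset.sum_congr rfl hgap, Finset.sum_sub_distrib, ← Finset.mul_sum, ← Finset.mul_sum, Finset.sum_add_distrib,
    halt, htel]
  -- the boundary terms vanish: `F(0) = F(π) = 0`
  have hF0 : F (a 0) = 0 := by simp [ha, hFdef]
  have han : a n = π := by simp only [ha]; rw [mul_div_assoc, mul_div_cancel₀ _ hnr.ne']
  have hFπ : F (a n) = 0 := by rw [han]; simp [hFdef]
  rw [hF0, hFπ]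
  simp only [mul_zero, sub_zero, add_zero, zero_sub]
  -- the gap integrals assemble to `∫_0^π`
  have hdm : Measurable (deriv F) := measurable_deriv F
  have hdb : ∀ θ, |deriv F θ| ≤ K + B := abs_deriv_compCos_mul_sin_le hK hB
  have hprod_int : ∀ c d : ℝ, IntervalIntegrable (fun θ => deriv F θ * Real.arccos (Real.cos (n * θ))) volume c d :=
    fun c d => (intervalIntegrable_of_bounded hdm hdb c d).mul_continuousOn
      ((Real.continuous_arccos.comp (Real.continuous_cos.comp (continuous_const.mul continuous_id))).continuousOn)
  have hadj := intervalIntegral.sum_integral_adjacent_intervals (a := a) (n := n) (μ := volume)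
    (f := fun θ => deriv F θ * Real.arccos (Real.cos (n * θ))) fun k _ => hprod_int _ _
  have ha0 : a 0 = 0 := by simp [ha]
  rw [hadj, ha0, han]
  -- remove the mean `π∕2`: `∫_0^π F′ = F(π) − F(0) = 0`
  have hFacπ : AbsolutelyContinuousOnInterval F 0 π :=
    ((lipschitzWith_compCos_mul_sin hK hB).lipschitzOnWith (s := Set.uIcc 0 π)).absolutelyContinuousOnInterval
  have hint0 : ∫ θ in (0 : ℝ)..π, deriv F θ = 0 := by
    rw [hFacπ.integral_deriv_eq_sub]
    simp [hFdef]
  have hsplit : ∫ θ in (0 : ℝ)..π, deriv F θ * (Real.arccos (Real.cos (n * θ)) - π / 2) =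
      (∫ θ in (0 : ℝ)..π, deriv F θ * Real.arccos (Real.cos (n * θ))) - π / 2 * ∫ θ in (0 : ℝ)..π, deriv F θ := by
    rw [← intervalIntegral.integral_const_mul, ← intervalIntegral.integral_sub (hprod_int 0 π)
      ((intervalIntegrable_of_bounded hdm hdb 0 π).const_mul _)]
    exact intervalIntegral.integral_congr fun θ _ => by ring
  rw [hsplit, hint0, mul_zero, sub_zero]
  ring

/-! ## §2 Absolute summability over the levels [folklore] -/

/-- ★★ **EVERY FIXED LIPSCHITZ TEST RIDES THE CHEBYSHEV ARCS ABSOLUTELY SUMMABLY.**  For a continuous `G`, `K`-Lipschitz and `B`-bounded on `[−1,1]`,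
and every `N`: `Σ_{n=1}^{N} |Σ_{k<n} (−1)^k ∫_{x_{k+1}}^{x_k} G| ≤ (π³∕6)·(K + B)` — §1 and module 86's square-function bound with `f = F′`, `|F′| ≤ K+B`.
(The trivial bound per level is `O((K+B)∕n)`, harmonic; the gain is the orthogonality of the odd harmonics of the triangle waves.) [folklore] -/
theorem sum_abs_altArc_le (hG : Continuous G)
    (hK : ∀ x y : ℝ, x ∈ Set.Icc (-1 : ℝ) 1 → y ∈ Set.Icc (-1 : ℝ) 1 → |G x - G y| ≤ K * |x - y|)
    (hB : ∀ x : ℝ, x ∈ Set.Icc (-1 : ℝ) 1 → |G x| ≤ B) (N : ℕ) :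
    ∑ n ∈ Finset.range N, |∑ k ∈ Finset.range (n + 1), (-1 : ℝ) ^ k * ∫ x in node (n + 1) (k + 1)..node (n + 1) k, G x| ≤
      π ^ 3 / 6 * (K + B) := by
  have hK0 := lipConst_nonneg hK
  have hB0 := bound_nonneg hB
  rcases (add_nonneg hK0 hB0).eq_or_lt with h0 | hpos
  · -- degenerate `K = B = 0`: `G = 0` on `[−1,1]`, every arc integral vanishes
    have hB' : B = 0 := by linarith
    have hG0 : ∀ x ∈ Set.Icc (-1 : ℝ) 1, G x = 0 := fun x hx => abs_eq_zero.1 (le_antisymm (hB' ▸ hB x hx) (abs_nonneg _))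
    have hterm : ∀ n k : ℕ, k < n → ∫ x in node n (k + 1)..node n k, G x = 0 := fun n k hk => by
      rw [intervalIntegral.integral_congr (g := fun _ => (0 : ℝ)) fun x hx => ?_, intervalIntegral.integral_zero]
      rw [Set.uIcc_of_le (node_succ_lt hk).le] at hx
      exact hG0 x ⟨(node_mem_Icc (n := n) (i := k + 1)).1.trans hx.1, hx.2.trans (node_mem_Icc (n := n) (i := k)).2⟩
    rw [← h0, mul_zero]
    refine (Finset.sum_eq_zero fun n _ => ?_).le
    rw [abs_eq_zero]
    exact Finset.sum_eq_zero fun k hk => by rw [hterm (n + 1) k (Finset.mem_range.1 hk), mul_zero]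
  · have hdm : Measurable (deriv (fun θ : ℝ => G (Real.cos θ) * Real.sin θ)) := measurable_deriv _
    have hdb : ∀ θ, |deriv (fun θ : ℝ => G (Real.cos θ) * Real.sin θ) θ| ≤ K + B := abs_deriv_compCos_mul_sin_le hK hB
    have h := sum_div_abs_integral_mul_triangle_le hdm hpos hdb N
    refine le_trans (le_of_eq (Finset.sum_congr rfl fun n _ => ?_)) h
    rw [altArc_eq_neg_div_integral_deriv_mul_triangle hG hK hB (Nat.succ_ne_zero n)]
    push_cast
    rw [abs_mul, abs_neg, abs_of_pos (by positivity : (0 : ℝ) < 1 / ((n : ℝ) + 1))]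

/-- ★★ Summable form: the level series `Σ_{n≥1} |Σ_{k<n}(−1)^k∫_{x_{k+1}}^{x_k} G|` converges, with sum `≤ (π³∕6)(K+B)`. [folklore] -/
theorem summable_abs_altArc (hG : Continuous G)
    (hK : ∀ x y : ℝ, x ∈ Set.Icc (-1 : ℝ) 1 → y ∈ Set.Icc (-1 : ℝ) 1 → |G x - G y| ≤ K * |x - y|)
    (hB : ∀ x : ℝ, x ∈ Set.Icc (-1 : ℝ) 1 → |G x| ≤ B) :
    Summable (fun n : ℕ => |∑ k ∈ Finset.range (n + 1), (-1 : ℝ) ^ k * ∫ x in node (n + 1) (k + 1)..node (n + 1) k, G x|) ∧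
      ∑' n : ℕ, |∑ k ∈ Finset.range (n + 1), (-1 : ℝ) ^ k * ∫ x in node (n + 1) (k + 1)..node (n + 1) k, G x| ≤
        π ^ 3 / 6 * (K + B) :=
  ⟨summable_of_sum_range_le (fun _ => abs_nonneg _) (sum_abs_altArc_le hG hK hB),
    Real.tsum_le_of_sum_range_le (fun _ => abs_nonneg _) (sum_abs_altArc_le hG hK hB)⟩

/-- The same bound for the alternating functional indexed by the level `n` itself (the `n = 0` term is an empty sum). [bookkeeping] -/
theorem sum_range_abs_altArc_le (hG : Continuous G)
    (hK : ∀ x y : ℝ, x ∈ Set.Icc (-1 : ℝ) 1 → y ∈ Set.Icc (-1 : ℝ) 1 → |G x - G y| ≤ K * |x - y|)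
    (hB : ∀ x : ℝ, x ∈ Set.Icc (-1 : ℝ) 1 → |G x| ≤ B) (N : ℕ) :
    ∑ n ∈ Finset.range N, |∑ k ∈ Finset.range n, (-1 : ℝ) ^ k * ∫ x in node n (k + 1)..node n k, G x| ≤ π ^ 3 / 6 * (K + B) := by
  cases N with
  | zero => simp only [Finset.range_zero, Finset.sum_empty]; exact mul_nonneg (by positivity) (add_nonneg (lipConst_nonneg hK) (bound_nonneg hB))
  | succ N => rw [Finset.sum_range_succ']; simpa using sum_abs_altArc_le hG hK hB N

end Test

end Summit.QuantumFields.YangMills.Theorems.BalabanUVNodesN19FixedTestArcChains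

end
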